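import Summits.QuantumFields.YangMills.Theorems.UnitScaleTiltFluctuationComparisonRegPrGlobalSlackKernelRescale
import HarnessLib

/-!
# `UnitScaleTiltFluctuationComparisonRegPrGlobalSlackKernelLegWeights` — PRINT'S LEG CURRENCY (43)×(44) FOR THE K1a INTERFACE: per-leg exponential weights absorb
# the distance growth of the loop variables, so the configuration rows hold at the record profile `p₀` WITHOUT the collar polylogarithm and the kernel rows need NO
# coupling factor (crux `FluctuationComparisonRegPrIntL`, stmt-QuantumFields-20520 — formerly 19935 —, STUB 3⁗ `stub_globalTwoRunSlackFam`; width-lever lane A;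
# OWNER ym3-torus-plan g23 RULING №1 §B W-slack-2)

Seat ym-ust-19935-slack g2 (prover).  THE LOCATED DEFECT (ym-cruxidea-19201-1 g15/g17 byte check; ym3-torus-lit g18 L-36 (A)).  The K1a chart line of record
(`GlobalSlackCanonicalPolymers.K1aChartRowsK`, p545118) reads ONE chart family `Φ` with SUP-NORM rows: `KernelSizeΦ` (operator norm of the flat kernels, `g`-free) and
`CfgSizeΦ` (sup norm of the configuration at the window profile `p₀`).  The displayed configuration bound (28) p.263 carries the collar polylogarithm `r(g) = (1 + log
g⁻¹)^{r₀}` in sup norm; the scalar rescaling of F-idea1-g14-1 (`…KernelRescale*`) pays it with the chart's birth coupling — fine for the perturbative family 𝒫′₁(g₀,·)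
((34) p.264, `O(g₀)`), but print MERGES the families and displays for the inductive family (43) p.266 «|𝒫_j(Y_j)| ≤ O(1)·Π_i exp(−κ₁(M₁Lʲη)⁻¹|c_{i,−} − y|)» — `O(1)`,
`g`-FREE, with PER-LEG exponential decay — and recovers smallness only at evaluation through the DISTANCE form (44) p.267 «|B_k(c)| < (Lʲη)⁻¹|c₋ − y|·8L²B₃ g p(g) (Lʲη)²»
(linear growth in the leg's distance, NO polylogarithm), (45)–(46).

THE REPAIR, IN THE INTERFACE'S OWN CURRENCY (print's (45) mechanism).  Rescale the chart pair by the BOND-DIAGONAL weight `D_w : x ↦ (e^{κ′d(c)}·x(c))_c` instead of a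
scalar: `Φ̃ := Φ ∘ D_w`, `B̃ := D_w⁻¹B`.  The jet is invariant (`jet26_comp_diag`), so `TaylorSplitΦ` is unchanged; `‖B̃‖_∞ = sup_c e^{−κ′d(c)}‖B(c)‖ ≤ C_s(1 + κ′⁻¹)·θ·x²` from
the distance form (`(1 + d)e^{−κ′d} ≤ 1 + κ′⁻¹`) — profile `p₀`, no polylogarithm; and `ker Φ̃ = ker Φ ∘ D_w^{⊗d}` (`ker_rescaleW`), whose operator norm is the
WEIGHTED kernel size — finite and `g`-free under (43)'s per-leg decay as soon as `κ′` is below the legs' decay rate (sibling file `…KernelLegEndToEnd`: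
`kernelLegΦ_of_pointwise`).  K1a in leg currency is the weighted two-run kernel difference (`FlatKernelLegCauchyΦ`), transported along the bond matching when the
distances are matched (`DistMatched`, the refinement-invariance of `|c − y|` in current-lattice units).

CONTENT.  §1 diagonal dilations `diagEquiv`, chain rule at all orders WITHOUT differentiability hypotheses (`iteratedFDeriv_comp_diag`, via
`ContinuousLinearEquiv.iteratedFDerivWithin_comp_right`), `jet26_comp_diag`.  §2 leg distances `LegDist`, weights `legW`/`legD`, the rescaled pair `rescaleΦw`/`rescaleBw`,
`ker_rescaleW`, `transport_legD`, `kerT_rescaleW`.  §3 the LEG-CURRENCY ROWS (hypothesis schemas): `DistNonneg`, `DistMatched`, `KernelLegΦ`, `FlatKernelLegCauchyΦ` (K1a),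
`CfgDistΦ` ((44)), `CfgDistCauchyΦ`.  §4 TRANSFER: `taylorSplitΦ_rescaleW`, `kernelSizeΦ_rescaleW`, `flatKernelCauchyΦ_rescaleW`, `cfgSizeΦ_rescaleW`, `cfgCauchyΦ_rescaleW`
— the leg rows for `(Φ, B)` give the four sup-norm rows of record for `(Φ̃, B̃)` at the SAME profile and decay, constants `× (1 + κ′⁻¹)`.
Every `def … : Prop` is a hypothesis schema (never asserted); the theorems are calculus and bookkeeping; nothing of [Balaban1985UV3]/[King1986] is asserted.

References: T. Bałaban, CMP 102 (1985) 255–275 [Balaban1985UV3] ((27)–(28) p.263, (30) p.263, (33)–(34) p.264, p.265 L13–16, (43)–(46) pp.266–267);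
C. King, CMP 102 (1986) 649–677 [King1986] (Prop. 3.6 (3.55)–(3.56) p.662, Prop. 3.9 (3.74) p.665).
-/

set_option autoImplicit false

noncomputable section

open scoped BigOperators
open Literature.MathematicalPhysics.QuantumFieldTheory.Balaban1983to89
open Literature.MathematicalPhysics.QuantumFieldTheory.Balaban1983to89.T3ContinuumYM3Torus
open Literature.MathematicalPhysics.QuantumFieldTheory.Balaban1983to89.T3UnitScaleTilt
open Literature.MathematicalPhysics.QuantumFieldTheory.Balaban1983to89.T3LevelShift
open Literature.MathematicalPhysics.QuantumFieldTheory.Balaban1983to89.T3AlphaInputsAC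
open Literature.MathematicalPhysics.QuantumFieldTheory.Balaban1983to89.T3AlphaPolymerSocket
open Literature.MathematicalPhysics.QuantumFieldTheory.Balaban1983to89.T3AlphaInputsACTwoRun
open Literature.MathematicalPhysics.QuantumFieldTheory.Balaban1983to89.T3AlphaInputsACTwoRunLevel
open Summit.QuantumFields.Balaban3D.Proofs.Representation33 (jet26)
open Summit.QuantumFields.YangMills.Theorems
open Summit.QuantumFields.YangMills.Theorems.GlobalSlackKernelMatching
open Summit.QuantumFields.YangMills.Theorems.GlobalSlackKernelRescale (dilateEquiv dilateEquiv_apply)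

namespace Summit.QuantumFields.YangMills.Theorems.GlobalSlackKernelLeg

/-! ## §1 Diagonal dilations and the jet: generic calculus -/

section Diag

variable {ι : Type*} {E G : Type*} [NormedAddCommGroup E] [NormedSpace ℂ E] [NormedAddCommGroup G] [NormedSpace ℂ G]

/-- **THE DIAGONAL DILATION** `x ↦ (w(c) • x(c))_c` of a finite product (`w(c) ≠ 0`), as a continuous linear automorphism. [folklore] -/
def diagEquiv (w : ι → ℂ) (hw : ∀ c, w c ≠ 0) : (ι → E) ≃L[ℂ] (ι → E) :=
  ContinuousLinearEquiv.piCongrRight fun c => dilateEquiv E (w c) (hw c)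

/-- `diagEquiv w x c = w c • x c`. [folklore] -/
theorem diagEquiv_apply (w : ι → ℂ) (hw : ∀ c, w c ≠ 0) (x : ι → E) (c : ι) : diagEquiv w hw x c = w c • x c := rfl

/-- `(diagEquiv w)⁻¹ x c = (w c)⁻¹ • x c`. [folklore] -/
theorem diagEquiv_symm_apply (w : ι → ℂ) (hw : ∀ c, w c ≠ 0) (x : ι → E) (c : ι) : (diagEquiv (E := E) w hw).symm x c = (w c)⁻¹ • x c := rfl

variable [Fintype ι]

/-- **Chain rule for a diagonal dilation, all orders, no differentiability hypothesis**: `Dⁿ(f ∘ D_w)(x) = Dⁿf(D_w x) ∘ D_w^{⊗n}`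
(`ContinuousLinearEquiv.iteratedFDerivWithin_comp_right` on `univ`). [folklore] -/
theorem iteratedFDeriv_comp_diag (f : (ι → E) → G) (w : ι → ℂ) (hw : ∀ c, w c ≠ 0) (x : ι → E) (n : ℕ) :
    iteratedFDeriv ℂ n (fun z => f (diagEquiv w hw z)) x =
      (iteratedFDeriv ℂ n f (diagEquiv w hw x)).compContinuousLinearMap fun _ => ((diagEquiv (E := E) w hw : (ι → E) →L[ℂ] (ι → E))) := by
  have h := (diagEquiv (E := E) w hw).iteratedFDerivWithin_comp_right f uniqueDiffOn_univ (Set.mem_univ ((diagEquiv (E := E) w hw) x)) n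
  rw [Set.preimage_univ, iteratedFDerivWithin_univ, iteratedFDerivWithin_univ] at h
  exact h

/-- `Dⁿ(f ∘ D_w)(0) = Dⁿf(0) ∘ D_w^{⊗n}`. [folklore] -/
theorem iteratedFDeriv_comp_diag_zero (f : (ι → E) → G) (w : ι → ℂ) (hw : ∀ c, w c ≠ 0) (n : ℕ) :
    iteratedFDeriv ℂ n (fun z => f (diagEquiv w hw z)) 0 =
      (iteratedFDeriv ℂ n f 0).compContinuousLinearMap fun _ => ((diagEquiv (E := E) w hw : (ι → E) →L[ℂ] (ι → E))) := by
  rw [iteratedFDeriv_comp_diag, map_zero]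

/-- **The jet is invariant under diagonal dilations**: `jet26 (f ∘ D_w) (D_w⁻¹ B) = jet26 f B`. [cite: Balaban1985UV3, (30) p.263] -/
theorem jet26_comp_diag (f : (ι → E) → G) (w : ι → ℂ) (hw : ∀ c, w c ≠ 0) (B : ι → E) :
    jet26 (fun z => f (diagEquiv w hw z)) ((diagEquiv (E := E) w hw).symm B) = jet26 f B := by
  unfold jet26
  refine Finset.sum_congr rfl fun n _ => ?_
  rw [iteratedFDeriv_comp_diag_zero, ContinuousMultilinearMap.compContinuousLinearMap_apply]
  simp only [ContinuousLinearEquiv.coe_coe, ContinuousLinearEquiv.apply_symm_apply]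

/-- `(M₁ − M₂) ∘ T = M₁ ∘ T − M₂ ∘ T` for multilinear maps precomposed slot-wise. [folklore] -/
theorem sub_compContinuousLinearMap {E₀ : Type*} [NormedAddCommGroup E₀] [NormedSpace ℂ E₀] {n : ℕ}
    (M₁ M₂ : ContinuousMultilinearMap ℂ (fun _ : Fin n => E₀) G) (T : E₀ →L[ℂ] E₀) :
    (M₁ - M₂).compContinuousLinearMap (fun _ => T) = M₁.compContinuousLinearMap (fun _ => T) - M₂.compContinuousLinearMap (fun _ => T) := by
  ext v
  simp only [ContinuousMultilinearMap.compContinuousLinearMap_apply, sub_apply]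

end Diag

/-! ## §2 Leg distances, weights, the rescaled pair -/

section Weights

variable {𝕍 : Type} [NormedAddCommGroup 𝕍] [NormedSpace ℂ 𝕍] {F : T3Family} {γ : ℝ}

/-- LEG DISTANCE FAMILY: run `K`, chart index `b`, domain `Y`, bond `c` ↦ print's `(M₁Lʲη)⁻¹|c₋ − y|`-type distance of the leg `c` from (the anchor of) `Y` in current-
lattice units (geometry of the polymer parameter; abstract here). [cite: Balaban1985UV3, (43)-(44) pp.266-267] -/
abbrev LegDist (F : T3Family) : Type := (K b : ℕ) → Set (Site (F.P K) 0) → PBond (F.P K) b → ℝ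

/-- The leg weight `e^{κ′·d(c)}` as a complex scalar. [cite: Balaban1985UV3, (45) p.267] -/
def legW (dist : LegDist F) (κ' : ℝ) (K b : ℕ) (Y : Set (Site (F.P K) 0)) (c : PBond (F.P K) b) : ℂ :=
  ((Real.exp (κ' * dist K b Y c) : ℝ) : ℂ)

omit [NormedAddCommGroup 𝕍] [NormedSpace ℂ 𝕍] in
/-- Leg weights are nonzero. [folklore] -/
theorem legW_ne_zero (dist : LegDist F) (κ' : ℝ) (K b : ℕ) (Y : Set (Site (F.P K) 0)) (c : PBond (F.P K) b) : legW dist κ' K b Y c ≠ 0 :=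
  Complex.ofReal_ne_zero.mpr (Real.exp_pos _).ne'

omit [NormedAddCommGroup 𝕍] [NormedSpace ℂ 𝕍] in
/-- `‖legW‖ = e^{κ′d}`. [folklore] -/
theorem norm_legW (dist : LegDist F) (κ' : ℝ) (K b : ℕ) (Y : Set (Site (F.P K) 0)) (c : PBond (F.P K) b) :
    ‖legW dist κ' K b Y c‖ = Real.exp (κ' * dist K b Y c) := by
  rw [legW, Complex.norm_real, Real.norm_of_nonneg (Real.exp_pos _).le]

omit [NormedAddCommGroup 𝕍] [NormedSpace ℂ 𝕍] in
/-- `‖legW⁻¹‖ = e^{−κ′d}`. [folklore] -/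
theorem norm_legW_inv (dist : LegDist F) (κ' : ℝ) (K b : ℕ) (Y : Set (Site (F.P K) 0)) (c : PBond (F.P K) b) :
    ‖(legW dist κ' K b Y c)⁻¹‖ = Real.exp (-(κ' * dist K b Y c)) := by
  rw [norm_inv, norm_legW, Real.exp_neg]

variable (𝕍) in
/-- **THE BOND-DIAGONAL WEIGHT MAP** `D_w : x ↦ (e^{κ′d(c)} • x(c))_c` on run `K`'s chart space at `(b, Y)`. [cite: Balaban1985UV3, (45) p.267] -/
def legD (dist : LegDist F) (κ' : ℝ) (K b : ℕ) (Y : Set (Site (F.P K) 0)) : (PBond (F.P K) b → 𝕍) ≃L[ℂ] (PBond (F.P K) b → 𝕍) :=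
  diagEquiv (legW dist κ' K b Y) (legW_ne_zero dist κ' K b Y)

/-- `D_w x c = e^{κ′d(c)} • x c`. [folklore] -/
theorem legD_apply (dist : LegDist F) (κ' : ℝ) (K b : ℕ) (Y : Set (Site (F.P K) 0)) (x : PBond (F.P K) b → 𝕍) (c : PBond (F.P K) b) :
    legD 𝕍 dist κ' K b Y x c = legW dist κ' K b Y c • x c := rfl

/-- `D_w⁻¹ x c = e^{−κ′d(c)} • x c`. [folklore] -/
theorem legD_symm_apply (dist : LegDist F) (κ' : ℝ) (K b : ℕ) (Y : Set (Site (F.P K) 0)) (x : PBond (F.P K) b → 𝕍) (c : PBond (F.P K) b) :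
    (legD 𝕍 dist κ' K b Y).symm x c = (legW dist κ' K b Y c)⁻¹ • x c := rfl

variable (𝕍) in
/-- The weight map as a continuous linear map (coercion spelled out once). [folklore] -/
abbrev legL (dist : LegDist F) (κ' : ℝ) (K b : ℕ) (Y : Set (Site (F.P K) 0)) : (PBond (F.P K) b → 𝕍) →L[ℂ] (PBond (F.P K) b → 𝕍) :=
  ((legD 𝕍 dist κ' K b Y : (PBond (F.P K) b → 𝕍) ≃L[ℂ] (PBond (F.P K) b → 𝕍)) : (PBond (F.P K) b → 𝕍) →L[ℂ] (PBond (F.P K) b → 𝕍))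

/-- `legL x = legD x`. [folklore] -/
theorem legL_apply (dist : LegDist F) (κ' : ℝ) (K b : ℕ) (Y : Set (Site (F.P K) 0)) (x : PBond (F.P K) b → 𝕍) :
    legL 𝕍 dist κ' K b Y x = legD 𝕍 dist κ' K b Y x := rfl

/-- **THE LEG-RESCALED CHART FAMILY** `Φ̃ K b Y := Φ K b Y ∘ D_w`. [cite: Balaban1985UV3, (30) p.263, (43) p.266] -/
def rescaleΦw (dist : LegDist F) (κ' : ℝ) (Φ : ChartFam 𝕍 F) : ChartFam 𝕍 F :=
  fun K b Y z => Φ K b Y (legD 𝕍 dist κ' K b Y z)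

/-- **THE LEG-RESCALED CONFIGURATION FAMILY** `B̃ K k b Y W := D_w⁻¹ (B K k b Y W)`, i.e. `B̃(c) = e^{−κ′d(c)}·B(c)`. [cite: Balaban1985UV3, (44) p.267] -/
def rescaleBw (dist : LegDist F) (κ' : ℝ) (B : CfgFam 𝕍 F) : CfgFam 𝕍 F :=
  fun K k b Y W => (legD 𝕍 dist κ' K b Y).symm (B K k b Y W)

/-- `B̃ … c = e^{−κ′d(c)} • B … c` (definitional). [folklore] -/
theorem rescaleBw_apply (dist : LegDist F) (κ' : ℝ) (B : CfgFam 𝕍 F) (K k b : ℕ) (Y : Set (Site (F.P K) 0))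
    (W : GaugeField (F.P K) k (Matrix.specialUnitaryGroup (Fin 2) ℂ)) (c : PBond (F.P K) b) :
    rescaleBw dist κ' B K k b Y W c = (legW dist κ' K b Y c)⁻¹ • B K k b Y W c := rfl

/-- **`ker Φ̃ = ker Φ ∘ D_w^{⊗d}`**. [cite: King1986, (3.55) p.662] -/
theorem ker_rescaleW (dist : LegDist F) (κ' : ℝ) (Φ : ChartFam 𝕍 F) (K b : ℕ) (Y : Set (Site (F.P K) 0)) (d : ℕ) :
    ker (rescaleΦw dist κ' Φ) K b Y d = (ker Φ K b Y d).compContinuousLinearMap fun _ => legL 𝕍 dist κ' K b Y :=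
  iteratedFDeriv_comp_diag_zero (Φ K b Y) _ _ d

/-- THE LEG DISTANCES ARE MATCHED ACROSS THE TWO RUNS (hypothesis schema, never asserted; geometry of `π`): the distance of the matched bond from the refined domain
in run `K+1` equals the distance of the bond from the domain in run `K` (both in current-lattice units — the two runs share the current lattice).
[cite: Balaban1987RG1, (0.1) p.251] -/
def DistMatched (dist : LegDist F) : Prop :=
  ∀ (K b : ℕ) (Y : Set (Site (F.P K) 0)) (c : PBond (F.P K) b), dist (K + 1) (b + 1) (refineSet F K Y) (matchBond F K b c) = dist K b Y c

/-- THE LEG DISTANCES ARE NONNEGATIVE (hypothesis schema, never asserted). [cite: Balaban1985UV3, (44) p.267] -/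
def DistNonneg (dist : LegDist F) : Prop :=
  ∀ (K b : ℕ) (Y : Set (Site (F.P K) 0)) (c : PBond (F.P K) b), 0 ≤ dist K b Y c

omit [NormedAddCommGroup 𝕍] [NormedSpace ℂ 𝕍] in
/-- Matched distances give matched weights. [folklore] -/
theorem legW_matched {dist : LegDist F} (h : DistMatched dist) (κ' : ℝ) (K b : ℕ) (Y : Set (Site (F.P K) 0)) (c : PBond (F.P K) b) :
    legW dist κ' (K + 1) (b + 1) (refineSet F K Y) (matchBond F K b c) = legW dist κ' K b Y c := by
  rw [legW, legW, h K b Y c]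

/-- **The weight maps commute with the bond transport** (matched distances): `transport ∘ D_w^{(K)} = D_w^{(K+1)} ∘ transport`. [cite: Balaban1987RG1, (0.1) p.251] -/
theorem transport_legD {dist : LegDist F} (h : DistMatched dist) (κ' : ℝ) (K b : ℕ) (Y : Set (Site (F.P K) 0)) (x : PBond (F.P K) b → 𝕍) :
    transport 𝕍 F K b (legD 𝕍 dist κ' K b Y x) = legD 𝕍 dist κ' (K + 1) (b + 1) (refineSet F K Y) (transport 𝕍 F K b x) := by
  funext c'
  rw [transport_apply, legD_apply, legD_apply, transport_apply]
  congr 1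
  conv_rhs => rw [← (matchBond F K b).apply_symm_apply c']
  rw [legW_matched h]

/-- **`kerT Φ̃ = kerT Φ ∘ D_w^{⊗d}`** (matched distances: the transported kernel of the rescaled family is the rescaled transported kernel). [cite: King1986, Prop. 3.6 (3.56) p.662] -/
theorem kerT_rescaleW {dist : LegDist F} (h : DistMatched dist) (κ' : ℝ) (Φ : ChartFam 𝕍 F) (K b : ℕ) (Y : Set (Site (F.P K) 0)) (d : ℕ) :
    kerT (rescaleΦw dist κ' Φ) K b Y d = (kerT Φ K b Y d).compContinuousLinearMap fun _ => legL 𝕍 dist κ' K b Y := by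
  unfold kerT
  rw [ker_rescaleW]
  ext v
  simp only [ContinuousMultilinearMap.compContinuousLinearMap_apply, legL_apply]
  congr 1
  funext i
  exact (transport_legD h κ' K b Y (v i)).symm

end Weights

/-! ## §3 The leg-currency rows (hypothesis schemas — never asserted) -/

section Rows

variable {𝕍 : Type} [NormedAddCommGroup 𝕍] [NormedSpace ℂ 𝕍] {F : T3Family} {γ : ℝ}

/-- **WEIGHTED KERNEL SIZE (leg currency)**: the operator norm of the order-`d` flat kernel PRECOMPOSED WITH THE LEG WEIGHTS `D_w^{⊗d}` is `≤ C_E·e^{−κ𝓛(Y)}` —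
print's (43) `O(1)·Π_i e^{−κ₁ d(c_i)}` summed against `e^{+κ′d(c_i)}`, `κ′ < κ₁` ((45): «summation over all Y_j with y fixed»); `g`-FREE, as printed for the merged
family (sibling file: `kernelLegΦ_of_pointwise`). [cite: Balaban1985UV3, (43) p.266, (45) p.267] -/
def KernelLegΦ (D : AlphaDataT3 F γ) (Φ : ChartFam 𝕍 F) (dist : LegDist F) (κ' κ C_E : ℝ) : Prop :=
  ∀ (K k b : ℕ) (Y : Set (Site (F.P K) 0)), Y ∈ D.Loc K k (D.triv K k) (1 + b) →
    ∀ d ∈ Finset.Ico 2 7,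
      ‖(ker Φ K b Y d).compContinuousLinearMap fun _ => legL 𝕍 dist κ' K b Y‖ ≤ C_E * Real.exp (-κ * D.treeLen K (1 + b) Y)

/-- **K1a IN LEG CURRENCY — WEIGHTED FLAT-KERNEL CAUCHY ROW**: the weighted difference of the transported order-`d` kernel of run `K+1` and the kernel of run `K` is
`≤ C·e^{−κ𝓛(Y)}·(L^{−(1+b)})^a` — [King1986] Prop. 3.6 for the merged `g`-free family, the unprinted number comparison (the core of 3⁗), now in the currency print
displays. [cite: King1986, Prop. 3.6 (3.56) p.662, Prop. 3.9 (3.74) p.665] -/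
def FlatKernelLegCauchyΦ (D : AlphaDataT3 F γ) (Φ : ChartFam 𝕍 F) (dist : LegDist F) (κ' κ a C : ℝ) : Prop :=
  ∀ (K k b : ℕ) (Y : Set (Site (F.P K) 0)), Y ∈ D.Loc K k (D.triv K k) (1 + b) →
    ∀ d ∈ Finset.Ico 2 7,
      ‖(kerT Φ K b Y d - ker Φ K b Y d).compContinuousLinearMap fun _ => legL 𝕍 dist κ' K b Y‖ ≤
        C * Real.exp (-κ * D.treeLen K (1 + b) Y) * (((F.L : ℝ) ^ (1 + b))⁻¹) ^ a

/-- **CONFIGURATION SIZE ROW IN DISTANCE FORM** (print's (44) p.267, both runs, run-`K` distances): leg by leg, `‖B(c)‖ ≤ C_s·(1 + d(c))·θ(n)·x²` at the WINDOW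
profile `p₀` — linear growth in the leg's distance instead of the sup-norm collar polylogarithm of (28). [cite: Balaban1985UV3, (44) p.267, (27)-(28) p.263] -/
def CfgDistΦ (D : AlphaDataT3 F γ) (B : CfgFam 𝕍 F) (dist : LegDist F) (b₀ p₀ C_s : ℝ) : Prop :=
  ∀ (K n : ℕ) (h : n ≤ K), ∀ j : ℕ, j < K - n →
    ∀ V : GaugeField (F.P n) 0 (Matrix.specialUnitaryGroup (Fin 2) ℂ), PlaqSmall (θBal F.L γ b₀ p₀ n) V →
      ∀ Y ∈ D.Loc K (K - n) (D.triv K (K - n)) (1 + j), ∀ c : PBond (F.P K) j,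
        ‖B K (K - n) j Y
            (fieldShift (F.sitesPerDir_eq (m := F.m) (K := K) (j := K - n) (m' := F.m) (K' := n) (j' := 0) (by omega)) V) c‖ ≤
          C_s * (1 + dist K j Y c) * θBal F.L γ b₀ p₀ n * (((F.L : ℝ) ^ (K - n - 1 - j))⁻¹) ^ 2 ∧
        ‖B (K + 1) (K + 1 - n) (j + 1) (refineSet F K Y)
            (fieldShift (F.sitesPerDir_eq (m := F.m) (K := K + 1) (j := K + 1 - n) (m' := F.m) (K' := n) (j' := 0) (by omega)) V)
            (matchBond F K j c)‖ ≤
          C_s * (1 + dist K j Y c) * θBal F.L γ b₀ p₀ n * (((F.L : ℝ) ^ (K - n - 1 - j))⁻¹) ^ 2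

/-- **CONFIGURATION CAUCHY ROW IN DISTANCE FORM** (the 19200-side content leg by leg, loss-free `ℓ ≡ 1`): `‖B′(c′) − B(c)‖ ≤ C_B·(1 + d(c))·θ(n)·x²·(L^{−(1+j)})^a`.
[cite: King1986, Prop. 3.9 (3.71) p.665; Balaban1985UV3, (44) p.267] -/
def CfgDistCauchyΦ (D : AlphaDataT3 F γ) (B : CfgFam 𝕍 F) (dist : LegDist F) (b₀ p₀ a C_B : ℝ) : Prop :=
  ∀ (K n : ℕ) (h : n ≤ K), ∀ j : ℕ, j < K - n →
    ∀ V : GaugeField (F.P n) 0 (Matrix.specialUnitaryGroup (Fin 2) ℂ), PlaqSmall (θBal F.L γ b₀ p₀ n) V →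
      ∀ Y ∈ D.Loc K (K - n) (D.triv K (K - n)) (1 + j), ∀ c : PBond (F.P K) j,
        ‖B (K + 1) (K + 1 - n) (j + 1) (refineSet F K Y)
              (fieldShift (F.sitesPerDir_eq (m := F.m) (K := K + 1) (j := K + 1 - n) (m' := F.m) (K' := n) (j' := 0) (by omega)) V)
              (matchBond F K j c) -
            B K (K - n) j Y
              (fieldShift (F.sitesPerDir_eq (m := F.m) (K := K) (j := K - n) (m' := F.m) (K' := n) (j' := 0) (by omega)) V) c‖ ≤
          C_B * (1 + dist K j Y c) * θBal F.L γ b₀ p₀ n * (((F.L : ℝ) ^ (K - n - 1 - j))⁻¹) ^ 2 * (((F.L : ℝ) ^ (1 + j))⁻¹) ^ a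

end Rows

/-! ## §4 Transfer: the leg rows for `(Φ, B)` give the sup-norm rows of record for `(Φ̃, B̃)` -/

section Transfer

variable {𝕍 : Type} [NormedAddCommGroup 𝕍] [NormedSpace ℂ 𝕍] {F : T3Family} {γ : ℝ}

/-- **The absorption constant**: `(1 + d)·e^{−κ′d} ≤ 1 + κ′⁻¹` for `d ≥ 0`, `κ′ > 0` (print's (45): the exponential leg decay absorbs the linear distance factor
of (44)). [cite: Balaban1985UV3, (45) p.267] -/
theorem one_add_mul_exp_neg_le {κ' d : ℝ} (hκ : 0 < κ') (hd : 0 ≤ d) : (1 + d) * Real.exp (-(κ' * d)) ≤ 1 + κ'⁻¹ := by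
  have h1 : Real.exp (-(κ' * d)) ≤ 1 := Real.exp_le_one_iff.mpr (by nlinarith)
  have h2 : κ' * d ≤ Real.exp (κ' * d) := by
    have := Real.add_one_le_exp (κ' * d - 1)
    have hm : Real.exp (κ' * d - 1) ≤ Real.exp (κ' * d) := Real.exp_le_exp.mpr (by linarith)
    linarith
  have h3 : d * Real.exp (-(κ' * d)) ≤ κ'⁻¹ := by
    rw [Real.exp_neg]
    have hE : 0 < Real.exp (κ' * d) := Real.exp_pos _
    rw [← div_eq_mul_inv, div_le_iff₀ hE, inv_mul_eq_div, le_div_iff₀ hκ]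
    linarith
  have h0 : 0 ≤ Real.exp (-(κ' * d)) := (Real.exp_pos _).le
  nlinarith

/-- `TaylorSplitΦ` is invariant under the leg rescaling (the jet is). [cite: Balaban1985UV3, (30) p.263, (43) p.266] -/
theorem taylorSplitΦ_rescaleW (dist : LegDist F) (κ' : ℝ) {PT : TermFn F} {Φ : ChartFam 𝕍 F} {e : VacFam F} {B : CfgFam 𝕍 F} {R : RemFam F}
    (h : TaylorSplitΦ PT Φ e B R) : TaylorSplitΦ PT (rescaleΦw dist κ' Φ) e (rescaleBw dist κ' B) R := by
  intro K k b Y W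
  have hj : jet26 (rescaleΦw dist κ' Φ K b Y) (rescaleBw dist κ' B K k b Y W) = jet26 (Φ K b Y) (B K k b Y W) :=
    jet26_comp_diag (Φ K b Y) (legW dist κ' K b Y) (legW_ne_zero dist κ' K b Y) (B K k b Y W)
  rw [h K k b Y W, hj]

/-- **`KernelSizeΦ` for the rescaled family = the weighted kernel size** (same decay, same constant, no coupling). [cite: Balaban1985UV3, (43) p.266, (45) p.267] -/
theorem kernelSizeΦ_rescaleW {D : AlphaDataT3 F γ} {Φ : ChartFam 𝕍 F} {dist : LegDist F} {κ' κ C_E : ℝ}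
    (h : KernelLegΦ D Φ dist κ' κ C_E) : KernelSizeΦ D (rescaleΦw dist κ' Φ) κ C_E := by
  intro K k b Y hY d hd
  rw [ker_rescaleW]
  exact h K k b Y hY d hd

/-- **K1a for the rescaled family = K1a in leg currency** (matched distances; same decay, rate and constant). [cite: King1986, Prop. 3.6 (3.56) p.662] -/
theorem flatKernelCauchyΦ_rescaleW {D : AlphaDataT3 F γ} {Φ : ChartFam 𝕍 F} {dist : LegDist F} {κ' κ a C : ℝ} (hm : DistMatched dist)
    (h : FlatKernelLegCauchyΦ D Φ dist κ' κ a C) : FlatKernelCauchyΦ D (rescaleΦw dist κ' Φ) κ a C := by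
  intro K k b Y hY d hd
  rw [kerT_rescaleW hm, ker_rescaleW, ← sub_compContinuousLinearMap]
  exact h K k b Y hY d hd

/-- The sup norm of a leg-rescaled configuration from a distance-form bound: `(∀ c, ‖x c‖ ≤ A·(1 + d(c))) ⟹ ‖D_w⁻¹x‖ ≤ A·(1 + κ′⁻¹)` (`A ≥ 0`, `d ≥ 0`, `κ′ > 0`).
[cite: Balaban1985UV3, (44)-(45) p.267] -/
theorem norm_weighted_le {dist : LegDist F} (hn : DistNonneg dist) {κ' : ℝ} (hκ : 0 < κ') {K b : ℕ} {Y : Set (Site (F.P K) 0)} {A : ℝ} (hA : 0 ≤ A)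
    (x : PBond (F.P K) b → 𝕍) (hx : ∀ c, ‖x c‖ ≤ A * (1 + dist K b Y c)) :
    ‖(fun c => (legW dist κ' K b Y c)⁻¹ • x c)‖ ≤ A * (1 + κ'⁻¹) := by
  have hr : 0 ≤ A * (1 + κ'⁻¹) := mul_nonneg hA (by positivity)
  refine (pi_norm_le_iff_of_nonneg hr).mpr fun c => ?_
  rw [norm_smul, norm_legW_inv]
  have hd := hn K b Y c
  calc Real.exp (-(κ' * dist K b Y c)) * ‖x c‖ ≤ Real.exp (-(κ' * dist K b Y c)) * (A * (1 + dist K b Y c)) :=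
        mul_le_mul_of_nonneg_left (hx c) (Real.exp_pos _).le
    _ = A * ((1 + dist K b Y c) * Real.exp (-(κ' * dist K b Y c))) := by ring
    _ ≤ A * (1 + κ'⁻¹) := mul_le_mul_of_nonneg_left (one_add_mul_exp_neg_le hκ hd) hA

/-- **`CfgSizeΦ` for the rescaled configurations from the distance form**, profile UNCHANGED, constant `C_s·(1 + κ′⁻¹)` (matched, nonnegative distances).
[cite: Balaban1985UV3, (44)-(45) p.267, (28) p.263] -/
theorem cfgSizeΦ_rescaleW {D : AlphaDataT3 F γ} {B : CfgFam 𝕍 F} {dist : LegDist F} {b₀ p₀ κ' C_s : ℝ} (hL : 1 ≤ F.L) (hγ : 0 < γ) (hγ1 : γ ≤ 1)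
    (hb : 0 < b₀) (hn : DistNonneg dist) (hm : DistMatched dist) (hκ : 0 < κ') (hCs : 0 ≤ C_s)
    (h : CfgDistΦ D B dist b₀ p₀ C_s) : CfgSizeΦ D (rescaleBw dist κ' B) b₀ p₀ (C_s * (1 + κ'⁻¹)) := by
  intro K n hnK j hj V hV Y hY
  have hθ : 0 ≤ θBal F.L γ b₀ p₀ n := (T3MinimiserStabilityReduction.θBal_pos hL hγ hγ1 hb p₀ n).le
  set x2 : ℝ := (((F.L : ℝ) ^ (K - n - 1 - j))⁻¹) ^ 2 with hx2
  have hx2' : 0 ≤ x2 := by positivity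
  have hA : 0 ≤ C_s * θBal F.L γ b₀ p₀ n * x2 := by positivity
  have hrow := h K n hnK j hj V hV Y hY
  refine ⟨?_, ?_⟩
  · have hle := norm_weighted_le (𝕍 := 𝕍) hn hκ (K := K) (b := j) (Y := Y) hA
      (B K (K - n) j Y (fieldShift (F.sitesPerDir_eq (m := F.m) (K := K) (j := K - n) (m' := F.m) (K' := n) (j' := 0) (by omega)) V))
      (fun c => by have := (hrow c).1; nlinarith [this])
    calc _ = ‖(fun c => (legW dist κ' K j Y c)⁻¹ •
          B K (K - n) j Y (fieldShift (F.sitesPerDir_eq (m := F.m) (K := K) (j := K - n) (m' := F.m) (K' := n) (j' := 0) (by omega)) V) c)‖ := rfl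
      _ ≤ C_s * θBal F.L γ b₀ p₀ n * x2 * (1 + κ'⁻¹) := hle
      _ = _ := by ring
  · have hle := norm_weighted_le (𝕍 := 𝕍) hn hκ (K := K) (b := j) (Y := Y) hA
      (fun c => B (K + 1) (K + 1 - n) (j + 1) (refineSet F K Y)
        (fieldShift (F.sitesPerDir_eq (m := F.m) (K := K + 1) (j := K + 1 - n) (m' := F.m) (K' := n) (j' := 0) (by omega)) V) (matchBond F K j c))
      (fun c => by have := (hrow c).2; nlinarith [this])
    have heq : (fun c => rescaleBw dist κ' B (K + 1) (K + 1 - n) (j + 1) (refineSet F K Y)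
        (fieldShift (F.sitesPerDir_eq (m := F.m) (K := K + 1) (j := K + 1 - n) (m' := F.m) (K' := n) (j' := 0) (by omega)) V) (matchBond F K j c)) =
        fun c => (legW dist κ' K j Y c)⁻¹ • B (K + 1) (K + 1 - n) (j + 1) (refineSet F K Y)
          (fieldShift (F.sitesPerDir_eq (m := F.m) (K := K + 1) (j := K + 1 - n) (m' := F.m) (K' := n) (j' := 0) (by omega)) V) (matchBond F K j c) := by
      funext c
      rw [rescaleBw_apply, legW_matched hm]
    rw [heq]
    calc _ ≤ C_s * θBal F.L γ b₀ p₀ n * x2 * (1 + κ'⁻¹) := hle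
      _ = _ := by ring

/-- **`CfgCauchyΦ (ℓ ≡ 1)` for the rescaled configurations from the distance-form Cauchy row**, constant `C_B·(1 + κ′⁻¹)`. [cite: King1986, Prop. 3.9 (3.71) p.665] -/
theorem cfgCauchyΦ_rescaleW {D : AlphaDataT3 F γ} {B : CfgFam 𝕍 F} {dist : LegDist F} {b₀ p₀ κ' a C_B : ℝ} (hL : 1 ≤ F.L) (hγ : 0 < γ) (hγ1 : γ ≤ 1)
    (hb : 0 < b₀) (hn : DistNonneg dist) (hm : DistMatched dist) (hκ : 0 < κ') (hCB : 0 ≤ C_B)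
    (h : CfgDistCauchyΦ D B dist b₀ p₀ a C_B) : CfgCauchyΦ D (rescaleBw dist κ' B) b₀ p₀ a (C_B * (1 + κ'⁻¹)) fun _ => 1 := by
  intro K n hnK j hj V hV Y hY
  have hθ : 0 ≤ θBal F.L γ b₀ p₀ n := (T3MinimiserStabilityReduction.θBal_pos hL hγ hγ1 hb p₀ n).le
  have hL0 : (0 : ℝ) < F.L := by exact_mod_cast (zero_lt_one.trans_le hL)
  set x2 : ℝ := (((F.L : ℝ) ^ (K - n - 1 - j))⁻¹) ^ 2 with hx2
  set ra : ℝ := (((F.L : ℝ) ^ (1 + j))⁻¹) ^ a with hra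
  have hx2' : 0 ≤ x2 := by positivity
  have hra' : 0 ≤ ra := by positivity
  have hA : 0 ≤ C_B * θBal F.L γ b₀ p₀ n * x2 * ra := by positivity
  have hrow := h K n hnK j hj V hV Y hY
  set x' := fun c => B (K + 1) (K + 1 - n) (j + 1) (refineSet F K Y)
    (fieldShift (F.sitesPerDir_eq (m := F.m) (K := K + 1) (j := K + 1 - n) (m' := F.m) (K' := n) (j' := 0) (by omega)) V) (matchBond F K j c) with hx'
  set x := B K (K - n) j Y (fieldShift (F.sitesPerDir_eq (m := F.m) (K := K) (j := K - n) (m' := F.m) (K' := n) (j' := 0) (by omega)) V) with hx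
  have hle := norm_weighted_le (𝕍 := 𝕍) hn hκ (K := K) (b := j) (Y := Y) hA (fun c => x' c - x c)
    (fun c => by have := hrow c; nlinarith [this])
  have heq : ((fun c => rescaleBw dist κ' B (K + 1) (K + 1 - n) (j + 1) (refineSet F K Y)
        (fieldShift (F.sitesPerDir_eq (m := F.m) (K := K + 1) (j := K + 1 - n) (m' := F.m) (K' := n) (j' := 0) (by omega)) V) (matchBond F K j c)) -
        rescaleBw dist κ' B K (K - n) j Y
          (fieldShift (F.sitesPerDir_eq (m := F.m) (K := K) (j := K - n) (m' := F.m) (K' := n) (j' := 0) (by omega)) V)) =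
      fun c => (legW dist κ' K j Y c)⁻¹ • (x' c - x c) := by
    funext c
    rw [Pi.sub_apply, rescaleBw_apply, legW_matched hm, smul_sub]
    rfl
  rw [heq]
  calc _ ≤ C_B * θBal F.L γ b₀ p₀ n * x2 * ra * (1 + κ'⁻¹) := hle
    _ = _ := by ring

end Transfer

end Summit.QuantumFields.YangMills.Theorems.GlobalSlackKernelLeg

end
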